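import Summits.BirchSwinnertonDyer.Rank1Residual.X4.KuriharaAdditiveCertificateOfExactness
import Summits.BirchSwinnertonDyer.Rank1Residual.X4.PlusFunctionalModPow
import Summits.BirchSwinnertonDyer.Rank1Residual.X4.PathFunctionOfFunctional
import Summits.BirchSwinnertonDyer.Rank1Residual.X4.PathFunctionInjectiveOfIhara
import HarnessLib

/-!
# THE ADDITIVE CERTIFICATE FROM CYCLES: for `f = f_E` the two-prime additive level-lowering certificate at `p^e` follows from the FREE decomposition of `\overline{[·]⁺_f}` ON `H₁(X₀(N), ℤ)`, two-prime EXACTNESS ON CYCLES for Hecke-stable, closing-supported families of functionals, and IHARA'S LEMMA BY NAME (cell `b2b-bsdres`, seat additive-p4 gen 32, line V54 — the assembly K91 ∘ K92 ∘ K94 ∘ K95 ∘ K96)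

HONEST FRAMING (verbatim, cell `b2b-bsdres`): the goal of the cell is to DELETE the COMBINATION-SHAPED
residual classes for ALL analytic-rank `≤ 1` curves over `ℚ` — "full BSD formula for every rank `≤ 1`
curve in class `C`" assembled STRICTLY from published theorems — so that the rank-`≤ 1` remainder
becomes exactly the CONSTRUCTION-SHAPED classes, which are TYPED (missing-input Props), NOT attempted;
this is not "finishing BSD". This file: ONE research-route KERNEL THEOREM (assembly; Ihara's lemma
enters BY NAME as `hI : ribet1984_iharaLemma`; no conjecture; nothing booked; X4 stays
CONSTRUCTION-SHAPED; no Literature fact is minted; labels unchanged; 0 defs).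

## What is proved

`plusSymbolLevelLowersAdditivelyModAt_of_cycles_of_ribet1984_iharaLemma`: DATA — `E = W/ℚ` globally
minimal, `p` odd with `E[p]` irreducible, `f` the newform of `E` at the conductor level `N`; two primes
`ℓ₁, ℓ₂ ∣ N`; levels `M₀, M₁ = M₀ℓ₂, M₂` with `M₂ ⊇`-divisibilities `M₀, M₀ℓ₁ ∣ M₂`, `M₁, M₁ℓ₁ ∣ N`,
`M₂, M₂ℓ₂ ∣ N`, `ℓ₂ ∤ M₀` (on the rows `M₀ = N/ℓ₁ℓ₂`, `M_i = N/ℓ_i`); a closing prime `q₀ ≡ 1 (mod N)` with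
`(a_{q₀}(E) − q₀ − 1)·u = 1` in `ℤ/p^e`; a maximal ideal `𝔫 ⊂ 𝕋̃(M₀)` with `2 ∉ 𝔫`, `T_{q₀} − q₀ − 1 ∉ 𝔫`;
families `𝓛₁, 𝓛₂, 𝓛₀` of `ℤ/p^e`-valued functions additive on `H₁` of levels `M₁, M₂, M₀`, Hecke-stable
(`Λ ↦ Λ(T_q •) − a_q(E)Λ`, `q ∤` level), stable under the closing operator, differences and scalars,
`𝓛₁, 𝓛₂` containing the pull-backs of `𝓛₀` and SUPPORTED on the closing operator, `𝓛₀` SUPPORTED at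
`𝔫` with the closing operator surjective on it; the cycle-level FREE decomposition
`\overline{[r]⁺_f} = (Λ₁(α¹{∞,r}) − Λ₁(β¹{∞,r})) + (Λ₂(α²{∞,r}) − Λ₂(β²{∞,r}))` for every CLOSED symbol
`{∞, r} ∈ H₁(X₀(N), ℤ)`, `Λ_i ∈ 𝓛_i`; and CYCLE-EXACTNESS of the old-space complex on `(𝓛₁, 𝓛₂, 𝓛₀)`.
CONCLUSION — `PlusSymbolLevelLowersAdditivelyModAt W p f (p^e) ℓ₁ ℓ₂`.
So the per-row inputs of the additive certificate are two finite statements on `H₁` (the FREE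
decomposition on cycles and the exactness at the f-block — instrument E11) plus numerals; the Kolyvagin
quantifiers, the `τ`-families, the `H`-stability and the injectivity are THEOREMS.

## References

* K. A. Ribet, Proc. ICM 1983 (1984), Thm. 4.1 — BY NAME. [cite: Ribet1984ICM, Thm. 4.1]
* B. Mazur, J. Tate, J. Teitelbaum, Invent. Math. 84 (1986), §I.4 (4.2), §I.8. [cite: MazurTateTeitelbaum1986Invent, §I.4 (4.2) and §I.8]
* C.-H. Kim, Amer. J. Math. 148 (2026), §1.4.3, §1.5.1. [cite: Kim2022StructureSelmer, §1.4.3 and §1.5.1 (PDF p. 7)]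
* Ju. I. Manin, Izv. Akad. Nauk SSSR 36 (1972), Cor. 3.6, Thm. 3.3 (20). [cite: Manin1972, Cor. 3.6]
-/

noncomputable section

open scoped MatrixGroups ModularForm

open CongruenceSubgroup Finset Matrix

open Literature.NumberTheory.EllipticCurves Literature.NumberTheory.EllipticCurves.ModularForms
  Literature.NumberTheory.EllipticCurves.ModularForms.HidaCohomology

open Literature.NumberTheory.DiophantineGeometry.Dioph (ratModP)

namespace Summit.BirchSwinnertonDyer.Rank1Residual.LevelLowering

section OfCycles

variable {W : WeierstrassCurve ℚ} [W.IsElliptic] [W.IsGloballyMinimal] {p : ℕ} [hp : Fact p.Prime]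

/-- **THE ADDITIVE CERTIFICATE OF `f_E` FROM CYCLE-LEVEL DATA AND IHARA'S LEMMA** (see the module
docstring for the data). [cite: Ribet1984ICM, Thm. 4.1] [cite: Kim2022StructureSelmer, §1.4.3 and §1.5.1 (PDF p. 7)]
[cite: MazurTateTeitelbaum1986Invent, §I.4 (4.2) and §I.8] [cite: Manin1972, Cor. 3.6] -/
theorem plusSymbolLevelLowersAdditivelyModAt_of_cycles_of_ribet1984_iharaLemma
    (hI : ribet1984_iharaLemma) (hp2 : p ≠ 2) (hirr : W.HasIrreducibleModPGaloisRep p)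
    {N : ℕ} [NeZero N] {f : CuspForm (Gamma0 N) 2} (hf : IsNewformOf W f)
    (hN : W.conductorNorm ℤ = N) {e ℓ₁ ℓ₂ M₀ M₂ : ℕ} [NeZero M₀] [NeZero M₂] [NeZero ℓ₁]
    [Fact ℓ₂.Prime] (hℓ₁N : ℓ₁ ∣ N) (hℓ₂N : ℓ₂ ∣ N) (hℓ₂M₀ : ¬ ℓ₂ ∣ M₀)
    (h02 : M₀ * 1 ∣ M₂) (h02' : M₀ * ℓ₁ ∣ M₂)
    (h1N : M₀ * ℓ₂ * 1 ∣ N) (h1N' : M₀ * ℓ₂ * ℓ₁ ∣ N) (h2N : M₂ * 1 ∣ N) (h2N' : M₂ * ℓ₂ ∣ N)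
    (σ0 : ℚ → Module.Dual ℂ (CuspForm (Gamma0 M₀) 2))
    (hσ0 : ∀ (r : ℚ) (g : CuspForm (Gamma0 M₀) 2), σ0 r g = modularSymbol g r)
    (σ1 : ℚ → Module.Dual ℂ (CuspForm (Gamma0 (M₀ * ℓ₂)) 2))
    (hσ1 : ∀ (r : ℚ) (g : CuspForm (Gamma0 (M₀ * ℓ₂)) 2), σ1 r g = modularSymbol g r)
    (σ2 : ℚ → Module.Dual ℂ (CuspForm (Gamma0 M₂) 2))
    (hσ2 : ∀ (r : ℚ) (g : CuspForm (Gamma0 M₂) 2), σ2 r g = modularSymbol g r)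
    (σN : ℚ → Module.Dual ℂ (CuspForm (Gamma0 N) 2))
    (hσN : ∀ (r : ℚ) (g : CuspForm (Gamma0 N) 2), σN r g = modularSymbol g r)
    {q₀ : ℕ} (hq₀ : q₀.Prime) (hq₀1 : q₀ ≡ 1 [MOD N]) (hq₀N : ¬ q₀ ∣ N)
    {u : ZMod (p ^ e)} (hu : (((W.frobeniusTrace q₀ : ℤ) : ZMod (p ^ e)) - ((q₀ + 1 : ℕ) : ZMod (p ^ e))) * u = 1)
    (𝔫 : Ideal (HeckeRing0.primeTo M₀ 2 (M₀ * ℓ₂))) (h𝔫 : 𝔫.IsMaximal)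
    (h2𝔫 : (2 : HeckeRing0.primeTo M₀ 2 (M₀ * ℓ₂)) ∉ 𝔫) (hq₀S : ¬ q₀ ∣ M₀ * ℓ₂)
    (hq₀E : HeckeRing0.primeTo.T M₀ 2 (M₀ * ℓ₂) hq₀ hq₀S -
      ((q₀ : HeckeRing0.primeTo M₀ 2 (M₀ * ℓ₂)) + 1) ∉ 𝔫)
    (𝓛₁ : Set (Module.Dual ℂ (CuspForm (Gamma0 (M₀ * ℓ₂)) 2) → ZMod (p ^ e)))
    (𝓛₂ : Set (Module.Dual ℂ (CuspForm (Gamma0 M₂) 2) → ZMod (p ^ e)))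
    (𝓛₀ : Set (Module.Dual ℂ (CuspForm (Gamma0 M₀) 2) → ZMod (p ^ e)))
    -- additivity
    (hadd₁ : ∀ Λ ∈ 𝓛₁, ∀ x ∈ periodHomology (M₀ * ℓ₂), ∀ y ∈ periodHomology (M₀ * ℓ₂), Λ (x + y) = Λ x + Λ y)
    (hadd₂ : ∀ Λ ∈ 𝓛₂, ∀ x ∈ periodHomology M₂, ∀ y ∈ periodHomology M₂, Λ (x + y) = Λ x + Λ y)
    (hadd₀ : ∀ Λ ∈ 𝓛₀, ∀ x ∈ periodHomology M₀, ∀ y ∈ periodHomology M₀, Λ (x + y) = Λ x + Λ y)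
    -- Hecke stability (`Λ ↦ Λ(T_q •) − a_q(E) Λ`, `q ∤` level)
    (hT₁ : ∀ Λ ∈ 𝓛₁, ∀ (q : ℕ) (hq : q.Prime), ¬ q ∣ M₀ * ℓ₂ →
      (fun z ↦ Λ (HeckeRing0.T (M₀ * ℓ₂) 2 q hq • z) - (W.frobeniusTrace q : ZMod (p ^ e)) * Λ z) ∈ 𝓛₁)
    (hT₂ : ∀ Λ ∈ 𝓛₂, ∀ (q : ℕ) (hq : q.Prime), ¬ q ∣ M₂ →
      (fun z ↦ Λ (HeckeRing0.T M₂ 2 q hq • z) - (W.frobeniusTrace q : ZMod (p ^ e)) * Λ z) ∈ 𝓛₂)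
    (hT₀ : ∀ Λ ∈ 𝓛₀, ∀ (q : ℕ) (hq : q.Prime), ¬ q ∣ M₀ →
      (fun z ↦ Λ (HeckeRing0.T M₀ 2 q hq • z) - (W.frobeniusTrace q : ZMod (p ^ e)) * Λ z) ∈ 𝓛₀)
    -- stability under the closing operator, differences, scalars
    (hA₁ : ∀ Λ ∈ 𝓛₁, (fun x ↦ Λ (HeckeRing0.T (M₀ * ℓ₂) 2 q₀ hq₀ • x - ((q₀ + 1 : ℕ) : ℂ) • x)) ∈ 𝓛₁)
    (hA₂ : ∀ Λ ∈ 𝓛₂, (fun x ↦ Λ (HeckeRing0.T M₂ 2 q₀ hq₀ • x - ((q₀ + 1 : ℕ) : ℂ) • x)) ∈ 𝓛₂)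
    (hsub₁ : ∀ Λ ∈ 𝓛₁, ∀ Λ' ∈ 𝓛₁, (fun x ↦ Λ x - Λ' x) ∈ 𝓛₁)
    (hsub₂ : ∀ Λ ∈ 𝓛₂, ∀ Λ' ∈ 𝓛₂, (fun x ↦ Λ x - Λ' x) ∈ 𝓛₂)
    (hsub₀ : ∀ Λ ∈ 𝓛₀, ∀ Λ' ∈ 𝓛₀, (fun x ↦ Λ x - Λ' x) ∈ 𝓛₀)
    (hsmul₁ : ∀ Λ ∈ 𝓛₁, ∀ c : ZMod (p ^ e), (fun x ↦ c * Λ x) ∈ 𝓛₁)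
    (hsmul₂ : ∀ Λ ∈ 𝓛₂, ∀ c : ZMod (p ^ e), (fun x ↦ c * Λ x) ∈ 𝓛₂)
    -- pull-backs
    (hpull₁ : ∀ Λ₀ ∈ 𝓛₀, (fun x ↦ Λ₀ ((degeneracyMap0 M₀ (M₀ * ℓ₂) 1 2).dualMap x) -
      1 * Λ₀ ((degeneracyMap0 M₀ (M₀ * ℓ₂) ℓ₂ 2).dualMap x)) ∈ 𝓛₁)
    (hpull₂ : ∀ Λ₀ ∈ 𝓛₀, (fun x ↦ -(Λ₀ ((degeneracyMap0 M₀ M₂ 1 2).dualMap x) -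
      1 * Λ₀ ((degeneracyMap0 M₀ M₂ ℓ₁ 2).dualMap x))) ∈ 𝓛₂)
    -- support on the closing operator / at `𝔫`, surjectivity of the closing operator on `𝓛₀`
    (hsupp₁ : ∀ Λ ∈ 𝓛₁, (∀ x ∈ periodHomology (M₀ * ℓ₂),
      Λ (HeckeRing0.T (M₀ * ℓ₂) 2 q₀ hq₀ • x - ((q₀ + 1 : ℕ) : ℂ) • x) = 0) →
      ∀ x ∈ periodHomology (M₀ * ℓ₂), Λ x = 0)
    (hsupp₂ : ∀ Λ ∈ 𝓛₂, (∀ x ∈ periodHomology M₂,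
      Λ (HeckeRing0.T M₂ 2 q₀ hq₀ • x - ((q₀ + 1 : ℕ) : ℂ) • x) = 0) → ∀ x ∈ periodHomology M₂, Λ x = 0)
    (hsupp₀ : ∀ Λ ∈ 𝓛₀, ∀ t : HeckeRing0.primeTo M₀ 2 (M₀ * ℓ₂), t ∉ 𝔫 →
      (∀ x ∈ periodHomology M₀, Λ ((t : HeckeRing0 M₀ 2) • x) = 0) → ∀ x ∈ periodHomology M₀, Λ x = 0)
    (hsurj₀ : ∀ Λ₀' ∈ 𝓛₀, ∃ Λ₀ ∈ 𝓛₀, ∀ x ∈ periodHomology M₀,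
      Λ₀ (HeckeRing0.T M₀ 2 q₀ hq₀ • x - ((q₀ + 1 : ℕ) : ℂ) • x) = Λ₀' x)
    -- THE TWO PER-ROW INPUTS: the FREE decomposition ON CYCLES …
    {Λ₁ : Module.Dual ℂ (CuspForm (Gamma0 (M₀ * ℓ₂)) 2) → ZMod (p ^ e)} (hΛ₁ : Λ₁ ∈ 𝓛₁)
    {Λ₂ : Module.Dual ℂ (CuspForm (Gamma0 M₂) 2) → ZMod (p ^ e)} (hΛ₂ : Λ₂ ∈ 𝓛₂)
    (hfree : ∀ r : ℚ, σN r ∈ periodHomology N → ratModP (p ^ e) (ratPlusSymbol f r) =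
      (Λ₁ ((degeneracyMap0 (M₀ * ℓ₂) N 1 2).dualMap (σN r)) -
        Λ₁ ((degeneracyMap0 (M₀ * ℓ₂) N ℓ₁ 2).dualMap (σN r))) +
      (Λ₂ ((degeneracyMap0 M₂ N 1 2).dualMap (σN r)) - Λ₂ ((degeneracyMap0 M₂ N ℓ₂ 2).dualMap (σN r))))
    -- … and CYCLE-LEVEL EXACTNESS
    (hexactC : ∀ Λ ∈ 𝓛₁, ∀ Λ' ∈ 𝓛₂,
      (∀ y ∈ periodHomology N,
        (Λ ((degeneracyMap0 (M₀ * ℓ₂) N 1 2).dualMap y) - 1 * Λ ((degeneracyMap0 (M₀ * ℓ₂) N ℓ₁ 2).dualMap y)) +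
        (Λ' ((degeneracyMap0 M₂ N 1 2).dualMap y) - 1 * Λ' ((degeneracyMap0 M₂ N ℓ₂ 2).dualMap y)) = 0) →
      ∃ Λ₀ ∈ 𝓛₀,
        (∀ x ∈ periodHomology (M₀ * ℓ₂), Λ x = Λ₀ ((degeneracyMap0 M₀ (M₀ * ℓ₂) 1 2).dualMap x) -
          1 * Λ₀ ((degeneracyMap0 M₀ (M₀ * ℓ₂) ℓ₂ 2).dualMap x)) ∧
        (∀ x ∈ periodHomology M₂, Λ' x = -(Λ₀ ((degeneracyMap0 M₀ M₂ 1 2).dualMap x) -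
          1 * Λ₀ ((degeneracyMap0 M₀ M₂ ℓ₁ 2).dualMap x)))) :
    PlusSymbolLevelLowersAdditivelyModAt W p f (p ^ e) ℓ₁ ℓ₂ := by
  have hℓ₂ : Fact ℓ₂.Prime := inferInstance
  haveI : NeZero ℓ₂ := ⟨hℓ₂.out.ne_zero⟩
  set a : ℕ → ZMod (p ^ e) := fun q ↦ (W.frobeniusTrace q : ZMod (p ^ e)) with ha
  -- divisibilities / congruences
  have hM1N : M₀ * ℓ₂ ∣ N := by simpa using h1N
  have hM2N : M₂ ∣ N := by simpa using h2N
  have hM0M1 : M₀ ∣ M₀ * ℓ₂ := dvd_mul_right _ _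
  have hq₀1M1 : q₀ ≡ 1 [MOD M₀ * ℓ₂] := hq₀1.of_dvd hM1N
  have hq₀1M2 : q₀ ≡ 1 [MOD M₂] := hq₀1.of_dvd hM2N
  have hq₀1M0 : q₀ ≡ 1 [MOD M₀] := hq₀1M1.of_dvd hM0M1
  have h01 : M₀ * 1 ∣ M₀ * ℓ₂ := by rw [mul_one]; exact dvd_mul_right _ _
  have h01' : M₀ * ℓ₂ ∣ M₀ * ℓ₂ := dvd_refl _
  have hℓ₁c : ℓ₁ ∣ W.conductorNorm ℤ := by rw [hN]; exact_mod_cast hℓ₁N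
  have hℓ₂c : ℓ₂ ∣ W.conductorNorm ℤ := by rw [hN]; exact_mod_cast hℓ₂N
  have hKN : ∀ q, Kato.IsKolyvaginPrime W p 1 q → ¬ q ∣ N := fun q hq h ↦
    hq.not_dvd_conductorNorm (by rw [hN]; exact_mod_cast h)
  -- the path-function sets
  set P₁ : Set (ℚ → ZMod (p ^ e)) := {μ | ∃ Λ ∈ 𝓛₁, ∀ r, μ r =
    Λ (HeckeRing0.T (M₀ * ℓ₂) 2 q₀ hq₀ • σ1 r - ((q₀ + 1 : ℕ) : ℂ) • σ1 r)} with hP₁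
  set P₂ : Set (ℚ → ZMod (p ^ e)) := {μ | ∃ Λ ∈ 𝓛₂, ∀ r, μ r =
    Λ (HeckeRing0.T M₂ 2 q₀ hq₀ • σ2 r - ((q₀ + 1 : ℕ) : ℂ) • σ2 r)} with hP₂
  set P₀ : Set (ℚ → ZMod (p ^ e)) := {μ | ∃ Λ ∈ 𝓛₀, ∀ r, μ r =
    Λ (HeckeRing0.T M₀ 2 q₀ hq₀ • σ0 r - ((q₀ + 1 : ℕ) : ℂ) • σ0 r)} with hP₀
  -- conversion between the `c = 1` form of K92/K94 and the constant-free form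
  have conv : ∀ {M : ℕ} [NeZero M] (𝓛 : Set (Module.Dual ℂ (CuspForm (Gamma0 M) 2) → ZMod (p ^ e)))
      (σ : ℚ → Module.Dual ℂ (CuspForm (Gamma0 M) 2)) (μ : ℚ → ZMod (p ^ e)),
      (∃ Λ ∈ 𝓛, ∀ r, μ r = Λ (HeckeRing0.T M 2 q₀ hq₀ • σ r - ((q₀ + 1 : ℕ) : ℂ) • σ r)) ↔
      (∃ Λ ∈ 𝓛, ∀ r, μ r = 1 * Λ (HeckeRing0.T M 2 q₀ hq₀ • σ r - ((q₀ + 1 : ℕ) : ℂ) • σ r)) := by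
    intro M _ 𝓛 σ μ
    constructor
    · rintro ⟨Λ, hΛ, h⟩; exact ⟨Λ, hΛ, fun r ↦ by rw [one_mul]; exact h r⟩
    · rintro ⟨Λ, hΛ, h⟩; exact ⟨Λ, hΛ, fun r ↦ by rw [h r, one_mul]⟩
  -- §A the mod-`p^e` plus functional and the path identity (K96)
  obtain ⟨PN, Ψ, hσP, hHP, hTP, hΨadd, hΨσ, hΨT⟩ := exists_plusFunctionalModPow (p := p) e f hf.1
    hf.coeffField_eq_bot (fun r ↦ Additive.norm_ratPlusSymbol_le_one_of_irreducible hp2 hf hirr r)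
    (fun q ↦ W.LFunction q) (fun q _ ↦ (hf.2 q).symm) σN hσN
  have haq₀ : ((W.LFunction q₀ : ℤ) : ZMod (p ^ e)) = (W.frobeniusTrace q₀ : ZMod (p ^ e)) := by
    have h1 : cuspCoeff f q₀ = ((W.LFunction q₀ : ℤ) : ℂ) := hf.2 q₀
    have h2 : cuspCoeff f q₀ = ((W.frobeniusTrace q₀ : ℤ) : ℂ) :=
      hf.cuspCoeff_eq_frobeniusTrace_of_not_dvd hq₀ hq₀N
    have : (W.LFunction q₀ : ℤ) = W.frobeniusTrace q₀ := by exact_mod_cast h1.symm.trans h2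
    rw [this]
  -- the cycle-level decomposition holds on all of `H₁(X₀(N))` (every cycle is `0` or a symbol)
  have hold : ∀ y ∈ periodHomology N, Ψ y =
      (Λ₁ ((degeneracyMap0 (M₀ * ℓ₂) N 1 2).dualMap y) - 1 * Λ₁ ((degeneracyMap0 (M₀ * ℓ₂) N ℓ₁ 2).dualMap y)) +
      (Λ₂ ((degeneracyMap0 M₂ N 1 2).dualMap y) - 1 * Λ₂ ((degeneracyMap0 M₂ N ℓ₂ 2).dualMap y)) := by
    intro y hy
    rcases exists_eq_zero_or_eq_symbol_of_mem_periodHomology σN hσN hy with rfl | ⟨r, rfl⟩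
    · have h0 : Ψ 0 = 0 := by
        have h := hΨadd 0 PN.zero_mem 0 PN.zero_mem
        rw [add_zero] at h
        linear_combination -h
      have h1 : Λ₁ 0 = 0 := by
        have h := hadd₁ Λ₁ hΛ₁ 0 (periodHomology _).zero_mem 0 (periodHomology _).zero_mem
        rw [add_zero] at h
        linear_combination -h
      have h2 : Λ₂ 0 = 0 := by
        have h := hadd₂ Λ₂ hΛ₂ 0 (periodHomology _).zero_mem 0 (periodHomology _).zero_mem
        rw [add_zero] at h
        linear_combination -h
      simp only [map_zero, h0, h1, h2]
      ring
    · rw [hΨσ, one_mul, one_mul]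
      exact hfree r hy
  -- §B the path identity `hsym` with `α = u μ_{Λ₁}`, `β = u μ_{Λ₂}` (K96)
  set α : ℚ → ZMod (p ^ e) := fun r ↦ u * Λ₁ (HeckeRing0.T (M₀ * ℓ₂) 2 q₀ hq₀ • σ1 r - ((q₀ + 1 : ℕ) : ℂ) • σ1 r)
    with hαdef
  set β : ℚ → ZMod (p ^ e) := fun r ↦ u * Λ₂ (HeckeRing0.T M₂ 2 q₀ hq₀ • σ2 r - ((q₀ + 1 : ℕ) : ℂ) • σ2 r)
    with hβdef
  have hsym : ∀ r : ℚ, ratModP (p ^ e) (ratPlusSymbol f r) =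
      (α r - α (ℓ₁ * r)) + (β r - β (ℓ₂ * r)) := by
    have h := decomposition_of_oldOnCycles (k := ZMod (p ^ e)) h1N h1N' h2N h2N' σ1 hσ1 σ2 hσ2 σN hσN hq₀ hq₀1
      hq₀N PN Ψ hσP hHP hΨadd (a := ((W.LFunction q₀ : ℤ) : ZMod (p ^ e)))
      (fun z hz ↦ hΨT q₀ hq₀ z hz) (fun r ↦ ratModP (p ^ e) (ratPlusSymbol f r)) hΨσ
      (u := u) (by rw [haq₀]; exact hu) 1 1 Λ₁ Λ₂ hold α β (fun r ↦ rfl) (fun r ↦ rfl)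
    intro r
    rw [h r, one_mul, one_mul]
  -- membership of `α, β`
  have hαP : α ∈ P₁ := ⟨fun x ↦ u * Λ₁ x, hsmul₁ Λ₁ hΛ₁ u, fun r ↦ rfl⟩
  have hβP : β ∈ P₂ := ⟨fun x ↦ u * Λ₂ x, hsmul₂ Λ₂ hΛ₂ u, fun r ↦ rfl⟩
  -- §C periodicity, `E_q`-stability, differences (K92)
  have hper : ∀ {M : ℕ} [NeZero M] (𝓛 : Set (Module.Dual ℂ (CuspForm (Gamma0 M) 2) → ZMod (p ^ e)))
      (σ : ℚ → Module.Dual ℂ (CuspForm (Gamma0 M) 2))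
      (hσ : ∀ (r : ℚ) (g : CuspForm (Gamma0 M) 2), σ r g = modularSymbol g r) (μ : ℚ → ZMod (p ^ e)),
      (∃ Λ ∈ 𝓛, ∀ r, μ r = Λ (HeckeRing0.T M 2 q₀ hq₀ • σ r - ((q₀ + 1 : ℕ) : ℂ) • σ r)) → IsPeriodic μ := by
    intro M _ 𝓛 σ hσ μ hμ
    exact isPeriodic_of_mem_pathFunSet 𝓛 σ hσ hq₀ 1 ((conv 𝓛 σ μ).mp hμ)
  have hstab : ∀ {M : ℕ} [NeZero M] (𝓛 : Set (Module.Dual ℂ (CuspForm (Gamma0 M) 2) → ZMod (p ^ e)))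
      (hadd : ∀ Λ ∈ 𝓛, ∀ x ∈ periodHomology M, ∀ y ∈ periodHomology M, Λ (x + y) = Λ x + Λ y)
      (hT : ∀ Λ ∈ 𝓛, ∀ (q : ℕ) (hq : q.Prime), ¬ q ∣ M →
        (fun z ↦ Λ (HeckeRing0.T M 2 q hq • z) - a q * Λ z) ∈ 𝓛)
      (σ : ℚ → Module.Dual ℂ (CuspForm (Gamma0 M) 2))
      (hσ : ∀ (r : ℚ) (g : CuspForm (Gamma0 M) 2), σ r g = modularSymbol g r)
      (hM : M ∣ N) (hq₀1M : q₀ ≡ 1 [MOD M]) (q : ℕ), Kato.IsKolyvaginPrime W p 1 q →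
      ∀ μ ∈ {μ : ℚ → ZMod (p ^ e) | ∃ Λ ∈ 𝓛, ∀ r, μ r = Λ (HeckeRing0.T M 2 q₀ hq₀ • σ r - ((q₀ + 1 : ℕ) : ℂ) • σ r)},
      heckeShift a q μ ∈ {μ : ℚ → ZMod (p ^ e) | ∃ Λ ∈ 𝓛, ∀ r, μ r =
        Λ (HeckeRing0.T M 2 q₀ hq₀ • σ r - ((q₀ + 1 : ℕ) : ℂ) • σ r)} := by
    intro M _ 𝓛 hadd hT σ hσ hM hq₀1M q hq μ hμ
    have hqM : ¬ q ∣ M := fun h ↦ hKN q hq (dvd_trans h hM)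
    obtain ⟨Λ', hΛ', h⟩ := heckeShift_mem_pathFunSet a 𝓛 hadd hT σ hσ hq₀ hq₀1M 1
      ((conv 𝓛 σ μ).mp hμ) hq.prime hqM
    exact ⟨Λ', hΛ', fun r ↦ by rw [h r, one_mul]⟩
  have hsubP : ∀ {M : ℕ} [NeZero M] (𝓛 : Set (Module.Dual ℂ (CuspForm (Gamma0 M) 2) → ZMod (p ^ e)))
      (hsub : ∀ Λ ∈ 𝓛, ∀ Λ' ∈ 𝓛, (fun x ↦ Λ x - Λ' x) ∈ 𝓛)
      (σ : ℚ → Module.Dual ℂ (CuspForm (Gamma0 M) 2)) (g h : ℚ → ZMod (p ^ e)),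
      g ∈ {μ : ℚ → ZMod (p ^ e) | ∃ Λ ∈ 𝓛, ∀ r, μ r = Λ (HeckeRing0.T M 2 q₀ hq₀ • σ r - ((q₀ + 1 : ℕ) : ℂ) • σ r)} →
      h ∈ {μ : ℚ → ZMod (p ^ e) | ∃ Λ ∈ 𝓛, ∀ r, μ r = Λ (HeckeRing0.T M 2 q₀ hq₀ • σ r - ((q₀ + 1 : ℕ) : ℂ) • σ r)} →
      (fun r ↦ g r - h r) ∈ {μ : ℚ → ZMod (p ^ e) | ∃ Λ ∈ 𝓛, ∀ r, μ r =
        Λ (HeckeRing0.T M 2 q₀ hq₀ • σ r - ((q₀ + 1 : ℕ) : ℂ) • σ r)} := by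
    intro M _ 𝓛 hsub σ g h hg hh
    obtain ⟨Λ, hΛ, hgΛ⟩ := hg
    obtain ⟨Λ', hΛ', hhΛ⟩ := hh
    exact ⟨fun x ↦ Λ x - Λ' x, hsub Λ hΛ Λ' hΛ', fun r ↦ by simp only [hgΛ r, hhΛ r]⟩
  -- §D injectivity of `1 − [ℓ₂]` on `P₀` from Ihara (K94)
  have hinj₀ : ∀ g ∈ P₀, (∀ r, g r - g (ℓ₂ * r) = 0) → g = fun _ ↦ 0 := by
    intro g hg hvan
    obtain ⟨Λ, hΛ, hgΛ⟩ := hg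
    exact pathFun_eq_zero_of_sub_smul_comp_eq_zero_of_ribet1984_iharaLemma hI hℓ₂M₀ 𝔫 h𝔫 h2𝔫 Λ
      (hadd₀ Λ hΛ) (hsupp₀ Λ hΛ) σ0 hσ0 σ1 hσ1 hq₀ hq₀1M1 hq₀S hq₀E isUnit_one 1 g
      (fun r ↦ by rw [hgΛ r, one_mul]) (fun r ↦ by rw [one_mul]; exact hvan r)
  -- §E exactness on the path-function sets from cycle-exactness (K95)
  have hexact : ∀ g ∈ P₁, ∀ h ∈ P₂, (∀ r, (g r - g (ℓ₁ * r)) + (h r - h (ℓ₂ * r)) = 0) →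
      ∃ z ∈ P₀, (g = fun r ↦ z r - z (ℓ₂ * r)) ∧ (h = fun r ↦ -(z r - z (ℓ₁ * r))) := by
    intro g hg h hh hsum
    have H := exact_pathFun_of_exact_cycles (k := ZMod (p ^ e)) h01 h01' h02 h02' h1N h1N' h2N h2N' σ0 hσ0 σ1 hσ1
      σ2 hσ2 σN hσN hq₀ hq₀1 hq₀N 1 1 𝓛₁ 𝓛₂ 𝓛₀ hadd₁ hadd₂ hA₁ hA₂ hsub₁ hsub₂ hpull₁ hpull₂
      hsupp₁ hsupp₂ hsurj₀ hexactC g hg h hh (fun r ↦ by rw [one_mul, one_mul]; exact hsum r)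
    obtain ⟨z, hz, hgz, hhz⟩ := H
    refine ⟨z, hz, ?_, ?_⟩
    · rw [hgz]; funext r; rw [one_mul]
    · rw [hhz]; funext r; rw [one_mul]
  -- §F assembly (K91)
  exact plusSymbolLevelLowersAdditivelyModAt_of_exact hℓ₁c hℓ₂c
    (hper 𝓛₁ σ1 hσ1 α hαP) (hper 𝓛₂ σ2 hσ2 β hβP) hαP hβP
    (fun q hq g hg ↦ hstab 𝓛₁ hadd₁ hT₁ σ1 hσ1 hM1N hq₀1M1 q hq g hg)
    (fun q hq g hg ↦ hstab 𝓛₂ hadd₂ hT₂ σ2 hσ2 hM2N hq₀1M2 q hq g hg)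
    (fun g hg ↦ hper 𝓛₀ σ0 hσ0 g hg)
    (fun g hg h hh ↦ hsubP 𝓛₀ hsub₀ σ0 g h hg hh)
    (fun q hq g hg ↦ hstab 𝓛₀ hadd₀ hT₀ σ0 hσ0 (dvd_trans hM0M1 hM1N) hq₀1M0 q hq g hg)
    hinj₀ hexact
    (fun q hq ↦ heckeShift_ratModP_ratPlusSymbol_eq_zero hp2 hf hirr e hq.prime (hKN q hq)) hsym

end OfCycles

end Summit.BirchSwinnertonDyer.Rank1Residual.LevelLowering

end
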